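import Summits.QuantumFields.YangMills.Theorems.UnitScaleGibbsMGFSecondMoment
import Summits.QuantumFields.YangMills.Theorems.U1TorusFluxGaussianDomination
import HarnessLib

/-!
# Gross's Gaussian domination (CMP 92 Thm 2.2) for Wilson `U(1)` on a torus — REAL cochains
# (LINE 28 «gross-sd-transfer» abelian sibling, crux `HistoryTailL` stmt-QuantumFields-19936; sequel to ✓`U1TorusFluxGaussianDomination`)

Cell `ym3-torus` (YM ladder rung R3 = continuum SU(2) Yang–Mills on T³ — a RUNG, NOT the Clay problem); WIDTH helper seat `ym3-torus-px8` g9.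
Helper `--supports stmt-QuantumFields-19936`; THEOREMS ONLY (0 `def`, 0 `sorry`, default heartbeats).

WHAT.  ✓`U1TorusFluxGaussianDomination.integral_exp_mul_flux_le` types Gross's Thm 2.2 for INTEGER 1-cochains `c` (the charges of lit
✓`U1WardIdentity.phaseFlow`).  Print states it for REAL exact 2-cochains `φ = du`.  This sequel removes that restriction WITHOUT real phase
flows and without new definitions: for a real 1-cochain `u : Edge d L → ℝ` the flux functional
`F(du)(U) = Σ_p (du)_p · Im U_p`, `(du)_{(x;i,j)} = u(x,i) + u(x+eᵢ,j) − u(x+eⱼ,i) − u(x,j)`, is the `u`-weighted combination of the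
integer-charge action derivatives, `F(du) = Σ_e u_e · actionFlowDeriv (Pi.single e 1)` (`realFlux_eq_sum_actionFlowDeriv`), because
`(du)_p = Σ_e u_e · plaqCharge (Pi.single e 1) p` (`realCobd_eq_sum_plaqCharge_single`); so the torus Ward identity applied EDGE BY EDGE
(flow `phaseFlow (Pi.single e 1)`, observable `e^{s·F(du)}`) and summed with weights `u_e` gives Gross's (4.6) verbatim
(★★ `integral_realFlux_mul_exp_eq`: `β·∫ F(du)·e^{sF(du)} dμ_β = s·∫ e^{sF(du)}·Σ_p (du)_p² Re U_p dμ_β`), whence the differential inequality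
with rate `‖du‖²∕β` (★★ `integral_realFlux_mul_exp_le`), the Grönwall step by ✓`UnitScaleGibbsMGFGronwall` (w8 g9 (α)), and

  ★★★ `integral_exp_mul_realFlux_le`:  `∫ exp(s·F(du)) dμ_β ≤ exp(s²·‖du‖²∕(2β))`  for every real `s`, `β > 0`, `d`, `L`, real `u`,

`‖du‖² = Σ_p (du)_p²`; plus the tail ★`measureReal_realFlux_ge_le` and the free variance bound ★★`integral_realFlux_sq_le`
(`∫ F(du)² dμ_β ≤ ‖du‖²∕β`, via px9 g9's (β) ✓`UnitScaleGibbsMGFSecondMoment`).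

HONEST SCOPE.  Abelian (`U(1)`), in print since 1983; periodic torus, Wilson energy `h = 1 − cos` (`α = 1`), lattice spacing 1.
TODO(general form): general energies `h` with A1–A3 and `h″ ≤ α`; infinite-volume translation-invariant Gibbs states via DLR.  Proves NOTHING
about SU(2): S_dom ∕ «BlockSecondMomentL» ∕ (Q) ∕ K1 ∕ `MeanDeviationL` ∕ `HistoryTailL` ∕ any crux or rung statement NOT proved or claimed.  YM₃ on
T³ is rung R3, not Clay; YM gap NOT proved; no summit statement is proved here.

Reference: L. Gross, Convergence of U(1)₃ lattice gauge theory to its continuum limit, CMP 92 (1983) 137–162, Thm 2.2, Lemma 4.1, §4 p. 153.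
-/

set_option autoImplicit false

noncomputable section

open scoped BigOperators
open MeasureTheory Set Filter
open Literature.MathematicalPhysics.QuantumFieldTheory Literature.MathematicalPhysics.QuantumLattice
open Summit.QuantumFields.YangMills.Theorems.UnitScaleGibbsMGFGronwall
open Summit.QuantumFields.YangMills.Theorems.UnitScaleGibbsMGFSecondMoment
open Summit.QuantumFields.YangMills.Theorems.U1TorusFluxGaussianDomination

namespace Summit.QuantumFields.YangMills.Theorems.U1TorusFluxGaussianDominationReal

variable {d L : ℕ}

/-! ## §1 The real coboundary and the real flux as weighted sums of integer charges -/

/-- `(du)_{(x;i,j)} = Σ_e u_e · plaqCharge (1_e) (x;i,j)`: the real coboundary is the `u`-weighted sum of the indicator charges. [folklore] -/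
theorem realCobd_eq_sum_plaqCharge_single [NeZero L] (u : Edge d L → ℝ) (x : Site d L) (i j : Fin d) :
    u (x, i) + u (x.shift i, j) - u (x.shift j, i) - u (x, j) =
      ∑ e : Edge d L, u e * (plaqCharge (Pi.single e (1 : ℤ)) x i j : ℝ) := by
  classical
  simp only [plaqCharge, Pi.single_apply, Int.cast_sub, Int.cast_add, Int.cast_ite, Int.cast_one, Int.cast_zero,
    mul_sub, mul_add, Finset.sum_sub_distrib, Finset.sum_add_distrib, mul_ite, mul_one, mul_zero,
    Finset.sum_ite_eq, Finset.mem_univ, if_true]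

/-- `F(du) = Σ_e u_e · actionFlowDeriv (1_e)`: the real flux is the `u`-weighted sum of the integer-charge action derivatives. [folklore] -/
theorem realFlux_eq_sum_actionFlowDeriv [NeZero L] (u : Edge d L → ℝ) (U : GaugeConfig d L Circle) :
    ∑ p : Plaquette d L, (u (p.1, p.2.1.1) + u (p.1.shift p.2.1.1, p.2.1.2) - u (p.1.shift p.2.1.2, p.2.1.1) - u (p.1, p.2.1.2)) *
        ((plaquetteHolonomy U p.1 p.2.1.1 p.2.1.2 : Circle) : ℂ).im =
      ∑ e : Edge d L, u e * actionFlowDeriv (Pi.single e (1 : ℤ)) U := by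
  simp only [actionFlowDeriv, Finset.mul_sum, realCobd_eq_sum_plaqCharge_single, Finset.sum_mul]
  rw [Finset.sum_comm]
  refine Finset.sum_congr rfl fun e _ => Finset.sum_congr rfl fun p _ => ?_
  ring

/-- The real coboundary is odd: `(d(−u))_p = −(du)_p`. [folklore] -/
theorem realCobd_neg (u : Edge d L → ℝ) (x : Site d L) (i j : Fin d) :
    (-u) (x, i) + (-u) (x.shift i, j) - (-u) (x.shift j, i) - (-u) (x, j) =
      -(u (x, i) + u (x.shift i, j) - u (x.shift j, i) - u (x, j)) := by
  simp only [Pi.neg_apply]; ring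

/-- `|F(du)(U)| ≤ Σ_p |(du)_p|` (`|Im U_p| ≤ 1`). [folklore] -/
theorem abs_realFlux_le [NeZero L] (u : Edge d L → ℝ) (U : GaugeConfig d L Circle) :
    |∑ p : Plaquette d L, (u (p.1, p.2.1.1) + u (p.1.shift p.2.1.1, p.2.1.2) - u (p.1.shift p.2.1.2, p.2.1.1) - u (p.1, p.2.1.2)) *
        ((plaquetteHolonomy U p.1 p.2.1.1 p.2.1.2 : Circle) : ℂ).im| ≤
      ∑ p : Plaquette d L, |u (p.1, p.2.1.1) + u (p.1.shift p.2.1.1, p.2.1.2) - u (p.1.shift p.2.1.2, p.2.1.1) - u (p.1, p.2.1.2)| := by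
  refine (Finset.abs_sum_le_sum_abs _ _).trans (Finset.sum_le_sum fun p _ => ?_)
  rw [abs_mul]
  exact (mul_le_mul_of_nonneg_left (abs_im_le_one _) (abs_nonneg _)).trans_eq (mul_one _)

/-- The real flux is continuous in the configuration. [folklore] -/
theorem continuous_realFlux [NeZero L] (u : Edge d L → ℝ) :
    Continuous fun U : GaugeConfig d L Circle => ∑ p : Plaquette d L,
      (u (p.1, p.2.1.1) + u (p.1.shift p.2.1.1, p.2.1.2) - u (p.1.shift p.2.1.2, p.2.1.1) - u (p.1, p.2.1.2)) *
        ((plaquetteHolonomy U p.1 p.2.1.1 p.2.1.2 : Circle) : ℂ).im := by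
  refine continuous_finsetSum _ fun p _ => continuous_const.mul ?_
  exact Complex.continuous_im.comp (continuous_subtype_val.comp (u1PlaqChar p.1 p.2.1.1 p.2.1.2).continuous)

/-- The weight `Σ_p (du)_p² Re U_p` is continuous in the configuration. [folklore] -/
theorem continuous_sum_cobdSq_mul_re [NeZero L] (u : Edge d L → ℝ) :
    Continuous fun U : GaugeConfig d L Circle => ∑ p : Plaquette d L,
      (u (p.1, p.2.1.1) + u (p.1.shift p.2.1.1, p.2.1.2) - u (p.1.shift p.2.1.2, p.2.1.1) - u (p.1, p.2.1.2)) ^ 2 *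
        ((plaquetteHolonomy U p.1 p.2.1.1 p.2.1.2 : Circle) : ℂ).re := by
  refine continuous_finsetSum _ fun p _ => continuous_const.mul ?_
  exact Complex.continuous_re.comp (continuous_subtype_val.comp (u1PlaqChar p.1 p.2.1.1 p.2.1.2).continuous)

/-- `Σ_p (du)_p² Re U_p ≤ ‖du‖²` (`Re U_p ≤ 1`). [cite: GrossCMP1983, §4 p. 153 «using h″(x) ≤ α»] -/
theorem sum_cobdSq_mul_re_le [NeZero L] (u : Edge d L → ℝ) (U : GaugeConfig d L Circle) :
    ∑ p : Plaquette d L, (u (p.1, p.2.1.1) + u (p.1.shift p.2.1.1, p.2.1.2) - u (p.1.shift p.2.1.2, p.2.1.1) - u (p.1, p.2.1.2)) ^ 2 *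
        ((plaquetteHolonomy U p.1 p.2.1.1 p.2.1.2 : Circle) : ℂ).re ≤
      ∑ p : Plaquette d L, (u (p.1, p.2.1.1) + u (p.1.shift p.2.1.1, p.2.1.2) - u (p.1.shift p.2.1.2, p.2.1.1) - u (p.1, p.2.1.2)) ^ 2 := by
  refine Finset.sum_le_sum fun p _ => ?_
  have h1 : ((plaquetteHolonomy U p.1 p.2.1.1 p.2.1.2 : Circle) : ℂ).re ≤ 1 := (abs_le.1 (abs_re_le_one _)).2
  nlinarith [sq_nonneg (u (p.1, p.2.1.1) + u (p.1.shift p.2.1.1, p.2.1.2) - u (p.1.shift p.2.1.2, p.2.1.1) - u (p.1, p.2.1.2))]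

/-- ★ The derivative of the real flux along the phase flow of ONE edge `e`: `d∕dt F(du)(φ^e_t U) = Σ_p (du)_p · plaqCharge(1_e)_p · Re (φ^e_t U)_p`.
[cite: GrossCMP1983, §4 (4.6)] -/
theorem hasDerivAt_realFlux_phaseFlow_single [NeZero L] (u : Edge d L → ℝ) (e : Edge d L) (U : GaugeConfig d L Circle) (t : ℝ) :
    HasDerivAt (fun s => ∑ p : Plaquette d L,
        (u (p.1, p.2.1.1) + u (p.1.shift p.2.1.1, p.2.1.2) - u (p.1.shift p.2.1.2, p.2.1.1) - u (p.1, p.2.1.2)) *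
          ((plaquetteHolonomy (phaseFlow (Pi.single e (1 : ℤ)) s U) p.1 p.2.1.1 p.2.1.2 : Circle) : ℂ).im)
      (∑ p : Plaquette d L,
        (u (p.1, p.2.1.1) + u (p.1.shift p.2.1.1, p.2.1.2) - u (p.1.shift p.2.1.2, p.2.1.1) - u (p.1, p.2.1.2)) *
          ((plaqCharge (Pi.single e (1 : ℤ)) p.1 p.2.1.1 p.2.1.2 : ℝ) *
            ((plaquetteHolonomy (phaseFlow (Pi.single e (1 : ℤ)) t U) p.1 p.2.1.1 p.2.1.2 : Circle) : ℂ).re)) t := by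
  simp only [plaquetteHolonomy_phaseFlow]
  refine HasDerivAt.fun_sum fun p _ => ?_
  exact (hasDerivAt_coe_exp_mul_im (plaqCharge (Pi.single e (1 : ℤ)) p.1 p.2.1.1 p.2.1.2 : ℝ)
    (plaquetteHolonomy U p.1 p.2.1.1 p.2.1.2) t).const_mul _

/-! ## §2 The Ward identity summed over edges with real weights, and the differential inequality -/

section Torus

variable [NeZero L]

/-- ★★ **GROSS'S (4.6) FOR A REAL COCHAIN.** For every `β`, real `u`, `s`:
`β · ∫ F(du)·e^{s·F(du)} dμ_β = s · ∫ e^{s·F(du)} · (Σ_p (du)_p² Re U_p) dμ_β` — the torus Ward identity ✓`u1_torus_ward_identity (Pi.single e 1) β`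
with the observable `e^{s·F(du)}`, for each edge `e`, multiplied by `u_e` and summed (`Σ_e u_e·plaqCharge(1_e)_p = (du)_p`,
`Σ_e u_e·actionFlowDeriv(1_e) = F(du)`). [cite: GrossCMP1983, Lemma 4.1 + (4.6)] -/
theorem integral_realFlux_mul_exp_eq (u : Edge d L → ℝ) (β s : ℝ) :
    β * ∫ U, (∑ p : Plaquette d L, (u (p.1, p.2.1.1) + u (p.1.shift p.2.1.1, p.2.1.2) - u (p.1.shift p.2.1.2, p.2.1.1) - u (p.1, p.2.1.2)) *
          ((plaquetteHolonomy U p.1 p.2.1.1 p.2.1.2 : Circle) : ℂ).im) *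
        Real.exp (s * ∑ p : Plaquette d L, (u (p.1, p.2.1.1) + u (p.1.shift p.2.1.1, p.2.1.2) - u (p.1.shift p.2.1.2, p.2.1.1) - u (p.1, p.2.1.2)) *
          ((plaquetteHolonomy U p.1 p.2.1.1 p.2.1.2 : Circle) : ℂ).im) ∂(wilsonMeasure u1Rep β) =
      s * ∫ U, Real.exp (s * ∑ p : Plaquette d L, (u (p.1, p.2.1.1) + u (p.1.shift p.2.1.1, p.2.1.2) - u (p.1.shift p.2.1.2, p.2.1.1) - u (p.1, p.2.1.2)) *
          ((plaquetteHolonomy U p.1 p.2.1.1 p.2.1.2 : Circle) : ℂ).im) *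
        (∑ p : Plaquette d L, (u (p.1, p.2.1.1) + u (p.1.shift p.2.1.1, p.2.1.2) - u (p.1.shift p.2.1.2, p.2.1.1) - u (p.1, p.2.1.2)) ^ 2 *
          ((plaquetteHolonomy U p.1 p.2.1.1 p.2.1.2 : Circle) : ℂ).re) ∂(wilsonMeasure u1Rep β) := by
  haveI := isProbabilityMeasure_wilsonMeasure (d := d) (L := L) u1Rep continuous_u1Rep β
  -- abbreviations
  set du : Plaquette d L → ℝ := fun p =>
    u (p.1, p.2.1.1) + u (p.1.shift p.2.1.1, p.2.1.2) - u (p.1.shift p.2.1.2, p.2.1.1) - u (p.1, p.2.1.2) with hdu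
  set X : GaugeConfig d L Circle → ℝ := fun U => ∑ p : Plaquette d L, du p *
    ((plaquetteHolonomy U p.1 p.2.1.1 p.2.1.2 : Circle) : ℂ).im with hX
  set n : Edge d L → Plaquette d L → ℝ := fun e p => (plaqCharge (Pi.single e (1 : ℤ)) p.1 p.2.1.1 p.2.1.2 : ℝ) with hn
  have hXc : Continuous X := continuous_realFlux (d := d) (L := L) u
  have hF : Continuous fun U : GaugeConfig d L Circle => Real.exp (s * X U) := Real.continuous_exp.comp (continuous_const.mul hXc)
  have hYe : ∀ e : Edge d L, Continuous fun U : GaugeConfig d L Circle => ∑ p : Plaquette d L, du p * (n e p *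
      ((plaquetteHolonomy U p.1 p.2.1.1 p.2.1.2 : Circle) : ℂ).re) := fun e => by
    refine continuous_finsetSum _ fun p _ => continuous_const.mul (continuous_const.mul ?_)
    exact Complex.continuous_re.comp (continuous_subtype_val.comp (u1PlaqChar p.1 p.2.1.1 p.2.1.2).continuous)
  -- the Ward identity for each edge flow
  have hward : ∀ e : Edge d L,
      ∫ U, Real.exp (s * X U) * (s * ∑ p : Plaquette d L, du p * (n e p *
          ((plaquetteHolonomy U p.1 p.2.1.1 p.2.1.2 : Circle) : ℂ).re)) ∂(wilsonMeasure u1Rep β) =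
        β * ∫ U, Real.exp (s * X U) * actionFlowDeriv (Pi.single e (1 : ℤ)) U ∂(wilsonMeasure u1Rep β) := by
    intro e
    have h := u1_torus_ward_identity (d := d) (L := L) (Pi.single e (1 : ℤ)) β
      (F := fun U => Real.exp (s * X U))
      (XF := fun U => Real.exp (s * X U) * (s * ∑ p : Plaquette d L, du p * (n e p *
          ((plaquetteHolonomy U p.1 p.2.1.1 p.2.1.2 : Circle) : ℂ).re)))
      hF (hF.mul (continuous_const.mul (hYe e))) fun U t =>
        (((hasDerivAt_realFlux_phaseFlow_single u e U t).const_mul s).exp).congr_deriv (by rw [hX, hdu, hn])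
    simpa only [wilsonExpectation] using h
  -- integrability of everything in sight (continuous functions, probability measure on a compact space)
  have hXS : ∀ e : Edge d L, Continuous (actionFlowDeriv (d := d) (L := L) (Pi.single e (1 : ℤ))) := fun e =>
    continuous_actionFlowDeriv _
  have hi1 : ∀ e : Edge d L, Integrable (fun U => u e * (Real.exp (s * X U) * (s * ∑ p : Plaquette d L, du p * (n e p *
      ((plaquetteHolonomy U p.1 p.2.1.1 p.2.1.2 : Circle) : ℂ).re)))) (wilsonMeasure u1Rep β) := fun e =>
    (continuous_const.mul (hF.mul (continuous_const.mul (hYe e)))).integrable_of_hasCompactSupport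
      (HasCompactSupport.of_compactSpace _)
  have hi2 : ∀ e : Edge d L, Integrable (fun U => u e * (Real.exp (s * X U) * actionFlowDeriv (Pi.single e (1 : ℤ)) U))
      (wilsonMeasure u1Rep β) := fun e =>
    (continuous_const.mul (hF.mul (hXS e))).integrable_of_hasCompactSupport (HasCompactSupport.of_compactSpace _)
  -- sum the Ward identities with weights `u_e`
  have hsum : ∑ e : Edge d L, u e * ∫ U, Real.exp (s * X U) * (s * ∑ p : Plaquette d L, du p * (n e p *
        ((plaquetteHolonomy U p.1 p.2.1.1 p.2.1.2 : Circle) : ℂ).re)) ∂(wilsonMeasure u1Rep β) =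
      β * ∑ e : Edge d L, u e * ∫ U, Real.exp (s * X U) * actionFlowDeriv (Pi.single e (1 : ℤ)) U ∂(wilsonMeasure u1Rep β) := by
    rw [Finset.mul_sum]
    refine Finset.sum_congr rfl fun e _ => ?_
    rw [hward e]; ring
  -- move the sums inside the integrals
  have hL : ∑ e : Edge d L, u e * ∫ U, Real.exp (s * X U) * (s * ∑ p : Plaquette d L, du p * (n e p *
        ((plaquetteHolonomy U p.1 p.2.1.1 p.2.1.2 : Circle) : ℂ).re)) ∂(wilsonMeasure u1Rep β) =
      ∫ U, Real.exp (s * X U) * (s * ∑ p : Plaquette d L, du p ^ 2 *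
        ((plaquetteHolonomy U p.1 p.2.1.1 p.2.1.2 : Circle) : ℂ).re) ∂(wilsonMeasure u1Rep β) := by
    simp_rw [← integral_const_mul]
    rw [← integral_finsetSum _ fun e _ => hi1 e]
    refine integral_congr_ae (ae_of_all _ fun U => ?_)
    beta_reduce
    have hcob : ∀ p : Plaquette d L, du p = ∑ e : Edge d L, u e * n e p := fun p =>
      realCobd_eq_sum_plaqCharge_single u p.1 p.2.1.1 p.2.1.2
    have : ∑ e : Edge d L, u e * (Real.exp (s * X U) * (s * ∑ p : Plaquette d L, du p * (n e p *
        ((plaquetteHolonomy U p.1 p.2.1.1 p.2.1.2 : Circle) : ℂ).re))) =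
        Real.exp (s * X U) * (s * ∑ p : Plaquette d L, du p * ((∑ e : Edge d L, u e * n e p) *
          ((plaquetteHolonomy U p.1 p.2.1.1 p.2.1.2 : Circle) : ℂ).re)) := by
      simp only [Finset.mul_sum, Finset.sum_mul]
      rw [Finset.sum_comm]
      refine Finset.sum_congr rfl fun p _ => Finset.sum_congr rfl fun e _ => ?_
      ring
    rw [this]
    congr 1; congr 1
    refine Finset.sum_congr rfl fun p _ => ?_
    rw [← hcob p]; ring
  have hR : ∑ e : Edge d L, u e * ∫ U, Real.exp (s * X U) * actionFlowDeriv (Pi.single e (1 : ℤ)) U ∂(wilsonMeasure u1Rep β) =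
      ∫ U, X U * Real.exp (s * X U) ∂(wilsonMeasure u1Rep β) := by
    simp_rw [← integral_const_mul]
    rw [← integral_finsetSum _ fun e _ => hi2 e]
    refine integral_congr_ae (ae_of_all _ fun U => ?_)
    beta_reduce
    have hflux : X U = ∑ e : Edge d L, u e * actionFlowDeriv (Pi.single e (1 : ℤ)) U :=
      realFlux_eq_sum_actionFlowDeriv u U
    rw [hflux, Finset.sum_mul]
    refine Finset.sum_congr rfl fun e _ => ?_
    ring
  rw [hL, hR] at hsum
  -- `hsum : ∫ e^{sX}·(s·Y) = β·∫ X e^{sX}`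
  rw [← hsum, ← integral_const_mul]
  refine integral_congr_ae (ae_of_all _ fun U => ?_)
  ring

/-- ★★ **THE DIFFERENTIAL INEQUALITY FOR A REAL COCHAIN** (rate `a = ‖du‖²∕β`, defect `Δ = 0`, weight `χ ≡ 1`): for `β > 0`, `s ≥ 0`,
`∫ F(du)·e^{s·F(du)}·1 dμ_β ≤ ((‖du‖²∕β)·s + 0)·∫ e^{s·F(du)}·1 dμ_β`. [cite: GrossCMP1983, §4 p. 153] -/
theorem integral_realFlux_mul_exp_le (u : Edge d L → ℝ) {β : ℝ} (hβ : 0 < β) {s : ℝ} (hs : 0 ≤ s) :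
    ∫ U, (∑ p : Plaquette d L, (u (p.1, p.2.1.1) + u (p.1.shift p.2.1.1, p.2.1.2) - u (p.1.shift p.2.1.2, p.2.1.1) - u (p.1, p.2.1.2)) *
          ((plaquetteHolonomy U p.1 p.2.1.1 p.2.1.2 : Circle) : ℂ).im) *
        Real.exp (s * ∑ p : Plaquette d L, (u (p.1, p.2.1.1) + u (p.1.shift p.2.1.1, p.2.1.2) - u (p.1.shift p.2.1.2, p.2.1.1) - u (p.1, p.2.1.2)) *
          ((plaquetteHolonomy U p.1 p.2.1.1 p.2.1.2 : Circle) : ℂ).im) * (1 : ℝ) ∂(wilsonMeasure u1Rep β) ≤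
      ((∑ p : Plaquette d L, (u (p.1, p.2.1.1) + u (p.1.shift p.2.1.1, p.2.1.2) - u (p.1.shift p.2.1.2, p.2.1.1) - u (p.1, p.2.1.2)) ^ 2) / β * s + 0) *
        ∫ U, Real.exp (s * ∑ p : Plaquette d L, (u (p.1, p.2.1.1) + u (p.1.shift p.2.1.1, p.2.1.2) - u (p.1.shift p.2.1.2, p.2.1.1) - u (p.1, p.2.1.2)) *
          ((plaquetteHolonomy U p.1 p.2.1.1 p.2.1.2 : Circle) : ℂ).im) * (1 : ℝ) ∂(wilsonMeasure u1Rep β) := by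
  haveI := isProbabilityMeasure_wilsonMeasure (d := d) (L := L) u1Rep continuous_u1Rep β
  simp only [mul_one, add_zero]
  set du : Plaquette d L → ℝ := fun p =>
    u (p.1, p.2.1.1) + u (p.1.shift p.2.1.1, p.2.1.2) - u (p.1.shift p.2.1.2, p.2.1.1) - u (p.1, p.2.1.2) with hdu
  set X : GaugeConfig d L Circle → ℝ := fun U => ∑ p : Plaquette d L, du p *
    ((plaquetteHolonomy U p.1 p.2.1.1 p.2.1.2 : Circle) : ℂ).im with hX
  have hXc : Continuous X := continuous_realFlux (d := d) (L := L) u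
  have hYc := continuous_sum_cobdSq_mul_re (d := d) (L := L) u
  have hF : Continuous fun U : GaugeConfig d L Circle => Real.exp (s * X U) := Real.continuous_exp.comp (continuous_const.mul hXc)
  have hiF : Integrable (fun U => Real.exp (s * X U)) (wilsonMeasure u1Rep β) :=
    hF.integrable_of_hasCompactSupport (HasCompactSupport.of_compactSpace _)
  have hiFY : Integrable (fun U => Real.exp (s * X U) * ∑ p : Plaquette d L, du p ^ 2 *
      ((plaquetteHolonomy U p.1 p.2.1.1 p.2.1.2 : Circle) : ℂ).re) (wilsonMeasure u1Rep β) :=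
    (hF.mul hYc).integrable_of_hasCompactSupport (HasCompactSupport.of_compactSpace _)
  have hpt : ∀ U : GaugeConfig d L Circle, Real.exp (s * X U) * (∑ p : Plaquette d L, du p ^ 2 *
      ((plaquetteHolonomy U p.1 p.2.1.1 p.2.1.2 : Circle) : ℂ).re) ≤ (∑ p : Plaquette d L, du p ^ 2) * Real.exp (s * X U) := fun U => by
    rw [mul_comm]
    exact mul_le_mul_of_nonneg_right (sum_cobdSq_mul_re_le u U) (Real.exp_pos _).le
  have hle : ∫ U, Real.exp (s * X U) * (∑ p : Plaquette d L, du p ^ 2 *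
      ((plaquetteHolonomy U p.1 p.2.1.1 p.2.1.2 : Circle) : ℂ).re) ∂(wilsonMeasure u1Rep β) ≤
      (∑ p : Plaquette d L, du p ^ 2) * ∫ U, Real.exp (s * X U) ∂(wilsonMeasure u1Rep β) := by
    rw [← integral_const_mul]
    exact integral_mono hiFY (hiF.const_mul _) hpt
  have hid := integral_realFlux_mul_exp_eq (d := d) (L := L) u β s
  have : ∫ U, X U * Real.exp (s * X U) ∂(wilsonMeasure u1Rep β) =
      s / β * ∫ U, Real.exp (s * X U) * (∑ p : Plaquette d L, du p ^ 2 *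
        ((plaquetteHolonomy U p.1 p.2.1.1 p.2.1.2 : Circle) : ℂ).re) ∂(wilsonMeasure u1Rep β) := by
    rw [div_mul_eq_mul_div]
    exact eq_div_of_mul_eq hβ.ne' (by rw [mul_comm]; exact hid)
  rw [this]
  calc s / β * ∫ U, Real.exp (s * X U) * (∑ p : Plaquette d L, du p ^ 2 *
        ((plaquetteHolonomy U p.1 p.2.1.1 p.2.1.2 : Circle) : ℂ).re) ∂(wilsonMeasure u1Rep β)
      ≤ s / β * ((∑ p : Plaquette d L, du p ^ 2) * ∫ U, Real.exp (s * X U) ∂(wilsonMeasure u1Rep β)) :=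
        mul_le_mul_of_nonneg_left hle (div_nonneg hs hβ.le)
    _ = (∑ p : Plaquette d L, du p ^ 2) / β * s * ∫ U, Real.exp (s * X U) ∂(wilsonMeasure u1Rep β) := by ring

/-! ## §3 Gaussian domination, tail and variance for real cochains -/

/-- The MGF for `s ≥ 0` (Grönwall via the (α) letters). [cite: GrossCMP1983, Thm 2.2] -/
theorem integral_exp_mul_realFlux_le_of_nonneg (u : Edge d L → ℝ) {β : ℝ} (hβ : 0 < β) {s : ℝ} (hs : 0 ≤ s) :
    ∫ U, Real.exp (s * ∑ p : Plaquette d L, (u (p.1, p.2.1.1) + u (p.1.shift p.2.1.1, p.2.1.2) - u (p.1.shift p.2.1.2, p.2.1.1) - u (p.1, p.2.1.2)) *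
          ((plaquetteHolonomy U p.1 p.2.1.1 p.2.1.2 : Circle) : ℂ).im) ∂(wilsonMeasure u1Rep β) ≤
      Real.exp ((∑ p : Plaquette d L, (u (p.1, p.2.1.1) + u (p.1.shift p.2.1.1, p.2.1.2) - u (p.1.shift p.2.1.2, p.2.1.1) - u (p.1, p.2.1.2)) ^ 2) / β *
        s ^ 2 / 2) := by
  haveI := isProbabilityMeasure_wilsonMeasure (d := d) (L := L) u1Rep continuous_u1Rep β
  have hXm := (continuous_realFlux (d := d) (L := L) u).measurable
  have hXB := abs_realFlux_le (d := d) (L := L) u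
  have hχm : Measurable fun _ : GaugeConfig d L Circle => (1 : ℝ) := measurable_const
  have hχM : ∀ U : GaugeConfig d L Circle, |(1 : ℝ)| ≤ 1 := fun _ => by simp
  have hχ0 : ∀ U : GaugeConfig d L Circle, (0 : ℝ) ≤ 1 := fun _ => zero_le_one
  have hmass : 0 < ∫ U, (1 : ℝ) ∂(wilsonMeasure (d := d) (L := L) u1Rep β) := by simp
  have hgron := le_mul_exp_of_deriv_le_linear_mul_of_mem
    (ψ := fun s => ∫ U, Real.exp (s * ∑ p : Plaquette d L, (u (p.1, p.2.1.1) + u (p.1.shift p.2.1.1, p.2.1.2) -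
        u (p.1.shift p.2.1.2, p.2.1.1) - u (p.1, p.2.1.2)) * ((plaquetteHolonomy U p.1 p.2.1.1 p.2.1.2 : Circle) : ℂ).im) * (1 : ℝ)
        ∂(wilsonMeasure u1Rep β))
    (ψ' := fun s => ∫ U, (∑ p : Plaquette d L, (u (p.1, p.2.1.1) + u (p.1.shift p.2.1.1, p.2.1.2) -
        u (p.1.shift p.2.1.2, p.2.1.1) - u (p.1, p.2.1.2)) * ((plaquetteHolonomy U p.1 p.2.1.1 p.2.1.2 : Circle) : ℂ).im) *
        Real.exp (s * ∑ p : Plaquette d L, (u (p.1, p.2.1.1) + u (p.1.shift p.2.1.1, p.2.1.2) -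
        u (p.1.shift p.2.1.2, p.2.1.1) - u (p.1, p.2.1.2)) * ((plaquetteHolonomy U p.1 p.2.1.1 p.2.1.2 : Circle) : ℂ).im) * (1 : ℝ)
        ∂(wilsonMeasure u1Rep β))
    (a := (∑ p : Plaquette d L, (u (p.1, p.2.1.1) + u (p.1.shift p.2.1.1, p.2.1.2) - u (p.1.shift p.2.1.2, p.2.1.1) -
        u (p.1, p.2.1.2)) ^ 2) / β) (Δ := 0) (T := s)
    (fun t _ => hasDerivAt_integral_exp_mul_weight (wilsonMeasure u1Rep β) hXm hχm hXB hχM t)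
    (fun t _ => integral_exp_mul_weight_pos (wilsonMeasure u1Rep β) hXm hχm hXB hχM hχ0 hmass t)
    (fun t ht => integral_realFlux_mul_exp_le u hβ ht.1) (s := s) ⟨hs, le_rfl⟩
  simp only [zero_mul, mul_one, Real.exp_zero, integral_const, probReal_univ, smul_eq_mul, one_mul,
    add_zero] at hgron
  exact hgron

/-- ★★★ **GROSS'S GAUSSIAN DOMINATION (CMP 92 Thm 2.2) FOR REAL COCHAINS, WILSON `U(1)` ON THE TORUS.** For every `β > 0`, every REAL
1-cochain `u` on `(ℤ∕L)^d` and every real `s`: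
`∫ exp(s·Σ_p (du)_p Im U_p) dμ_β ≤ exp(s²·Σ_p (du)_p² ∕ (2β))` — the flux of the exact 2-cochain `du` is sub-Gaussian with the free
(lattice-Maxwell) variance proxy `‖du‖²∕β`, at every coupling and volume. [cite: GrossCMP1983, Thm 2.2] -/
theorem integral_exp_mul_realFlux_le (u : Edge d L → ℝ) {β : ℝ} (hβ : 0 < β) (s : ℝ) :
    ∫ U, Real.exp (s * ∑ p : Plaquette d L, (u (p.1, p.2.1.1) + u (p.1.shift p.2.1.1, p.2.1.2) - u (p.1.shift p.2.1.2, p.2.1.1) - u (p.1, p.2.1.2)) *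
          ((plaquetteHolonomy U p.1 p.2.1.1 p.2.1.2 : Circle) : ℂ).im) ∂(wilsonMeasure u1Rep β) ≤
      Real.exp (s ^ 2 * (∑ p : Plaquette d L, (u (p.1, p.2.1.1) + u (p.1.shift p.2.1.1, p.2.1.2) - u (p.1.shift p.2.1.2, p.2.1.1) - u (p.1, p.2.1.2)) ^ 2) /
        (2 * β)) := by
  rcases le_total 0 s with hs | hs
  · refine (integral_exp_mul_realFlux_le_of_nonneg u hβ hs).trans_eq ?_
    congr 1; field_simp
  · have h := integral_exp_mul_realFlux_le_of_nonneg (d := d) (L := L) (-u) hβ (s := -s) (by linarith)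
    simp only [realCobd_neg, neg_mul, Finset.sum_neg_distrib, mul_neg, neg_neg, even_two, Even.neg_pow] at h
    refine h.trans_eq ?_
    congr 1; field_simp

/-- ★ **THE SUB-GAUSSIAN TAIL FOR REAL COCHAINS**: for `β > 0`, `s ≥ 0`, any `θ`, `μ_β{θ ≤ F(du)} ≤ exp(−sθ + (‖du‖²∕β)s²∕2)`.
[cite: GrossCMP1983, Thm 2.2 (consequence)] -/
theorem measureReal_realFlux_ge_le (u : Edge d L → ℝ) {β : ℝ} (hβ : 0 < β) {s : ℝ} (hs : 0 ≤ s) (θ : ℝ) :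
    (wilsonMeasure (d := d) (L := L) u1Rep β).real {U | θ ≤ ∑ p : Plaquette d L,
        (u (p.1, p.2.1.1) + u (p.1.shift p.2.1.1, p.2.1.2) - u (p.1.shift p.2.1.2, p.2.1.1) - u (p.1, p.2.1.2)) *
          ((plaquetteHolonomy U p.1 p.2.1.1 p.2.1.2 : Circle) : ℂ).im} ≤
      Real.exp (-(s * θ) + (∑ p : Plaquette d L, (u (p.1, p.2.1.1) + u (p.1.shift p.2.1.1, p.2.1.2) - u (p.1.shift p.2.1.2, p.2.1.1) -
        u (p.1, p.2.1.2)) ^ 2) / β * s ^ 2 / 2) := by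
  haveI := isProbabilityMeasure_wilsonMeasure (d := d) (L := L) u1Rep continuous_u1Rep β
  have hXm := (continuous_realFlux (d := d) (L := L) u).measurable
  have hXB := abs_realFlux_le (d := d) (L := L) u
  have hχm : Measurable fun _ : GaugeConfig d L Circle => (1 : ℝ) := measurable_const
  have hχM : ∀ U : GaugeConfig d L Circle, |(1 : ℝ)| ≤ 1 := fun _ => by simp
  have hχ0 : ∀ U : GaugeConfig d L Circle, (0 : ℝ) ≤ 1 := fun _ => zero_le_one
  have hmass : 0 < ∫ U, (1 : ℝ) ∂(wilsonMeasure (d := d) (L := L) u1Rep β) := by simp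
  have h := measureReal_le_of_gronwall (wilsonMeasure u1Rep β) hXm hχm hXB hχM hχ0 hmass hs
    (a := (∑ p : Plaquette d L, (u (p.1, p.2.1.1) + u (p.1.shift p.2.1.1, p.2.1.2) - u (p.1.shift p.2.1.2, p.2.1.1) -
        u (p.1, p.2.1.2)) ^ 2) / β) (Δ := 0)
    (fun t ht => integral_realFlux_mul_exp_le u hβ ht.1) θ
  simp only [and_true, integral_const, probReal_univ, smul_eq_mul, one_mul, zero_mul, add_zero] at h
  exact h

/-- ★★ **THE FREE VARIANCE BOUND FOR REAL EXACT FLUXES**: `∫ F(du)² dμ_β ≤ ‖du‖²∕β` (Gross Thm 2.5 I at `n = 1`), via the (β) letters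
on Thm 2.2 at `±t`. [cite: GrossCMP1983, Thm 2.5 I] -/
theorem integral_realFlux_sq_le (u : Edge d L → ℝ) {β : ℝ} (hβ : 0 < β) :
    ∫ U, (∑ p : Plaquette d L, (u (p.1, p.2.1.1) + u (p.1.shift p.2.1.1, p.2.1.2) - u (p.1.shift p.2.1.2, p.2.1.1) - u (p.1, p.2.1.2)) *
          ((plaquetteHolonomy U p.1 p.2.1.1 p.2.1.2 : Circle) : ℂ).im) ^ 2 ∂(wilsonMeasure u1Rep β) ≤
      (∑ p : Plaquette d L, (u (p.1, p.2.1.1) + u (p.1.shift p.2.1.1, p.2.1.2) - u (p.1.shift p.2.1.2, p.2.1.1) - u (p.1, p.2.1.2)) ^ 2) / β := by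
  haveI := isProbabilityMeasure_wilsonMeasure (d := d) (L := L) u1Rep continuous_u1Rep β
  have hXm := (continuous_realFlux (d := d) (L := L) u).measurable
  have hXB := abs_realFlux_le (d := d) (L := L) u
  have hχm : Measurable fun _ : GaugeConfig d L Circle => (1 : ℝ) := measurable_const
  have hχ0 : ∀ U : GaugeConfig d L Circle, (0 : ℝ) ≤ 1 := fun _ => zero_le_one
  have hχM : ∀ U : GaugeConfig d L Circle, (1 : ℝ) ≤ 1 := fun _ => le_rfl
  have hN : 0 ≤ (∑ p : Plaquette d L, (u (p.1, p.2.1.1) + u (p.1.shift p.2.1.1, p.2.1.2) - u (p.1.shift p.2.1.2, p.2.1.1) -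
      u (p.1, p.2.1.2)) ^ 2) / β := div_nonneg (Finset.sum_nonneg fun p _ => sq_nonneg _) hβ.le
  have key := integral_sq_mul_weight_le_of_subgaussian_mgf_nhds (wilsonMeasure u1Rep β) hXm hχm hXB hχ0 hχM
    one_pos hN (T := 1) ?_ ?_
  · simpa only [mul_one, integral_const, probReal_univ, smul_eq_mul] using key
  · intro t _
    have h := integral_exp_mul_realFlux_le (d := d) (L := L) u hβ t
    simp only [mul_one, integral_const, probReal_univ, smul_eq_mul, one_mul]
    refine h.trans_eq ?_
    congr 1; field_simp
  · intro t _
    have h := integral_exp_mul_realFlux_le (d := d) (L := L) u hβ (-t)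
    simp only [mul_one, integral_const, probReal_univ, smul_eq_mul, one_mul]
    refine (le_of_eq_of_le ?_ h).trans_eq ?_
    · refine integral_congr_ae (ae_of_all _ fun U => ?_); ring_nf
    · congr 1; field_simp

/-- The integer theorem is the special case `u = c` (cast): consistency with ✓`integral_exp_mul_flux_le`. [folklore] -/
theorem realFlux_intCast_eq_actionFlowDeriv (c : Edge d L → ℤ) (U : GaugeConfig d L Circle) :
    ∑ p : Plaquette d L, ((fun e => (c e : ℝ)) (p.1, p.2.1.1) + (fun e => (c e : ℝ)) (p.1.shift p.2.1.1, p.2.1.2) -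
        (fun e => (c e : ℝ)) (p.1.shift p.2.1.2, p.2.1.1) - (fun e => (c e : ℝ)) (p.1, p.2.1.2)) *
          ((plaquetteHolonomy U p.1 p.2.1.1 p.2.1.2 : Circle) : ℂ).im = actionFlowDeriv c U := by
  simp only [actionFlowDeriv, plaqCharge, Int.cast_sub, Int.cast_add]

end Torus

end Summit.QuantumFields.YangMills.Theorems.U1TorusFluxGaussianDominationReal

end
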